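/-
Copyright (c) 2026 the pub-hodgecm-mathlib formalisation cell (harness21).  Prover seat hodgecm-mathlib-F0P2-p11 (g4), chair K2-lead (g2) VALVE 35 (pp) «S8 FIRST TAKE» under the
S8 INTERIM ORDER (dealer R90-CS-plan (g3) CLOSED 03:25Z; interim desk R90-TF LEAD K2E1-plan (g8)), 2026-09-05T03:41Z: brick **PB-3a** of the E1-PLANCHEREL BODY of socket (E) :276
(census `R90/S8/CENSUS-PlancherelBody-bricks.K2E1-p16-F0P2-p10.md`): the UNRAMIFIED HECKE SHIFT of the radial pseudo-Eisenstein generators `θ_{f,ψ}` of `U(2,1)_{L∕L⁺}` —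
`Σ_i c_i·θ_{f,ψ}(·k_i) = θ_{f♮,ψ}` modulo ONE named local Satake letter, and the Mellin multiplier of the shifted profile `f♮`.  Consumer: K2E1-p16 (g4)'s PB-3 (`hHecke`, `hSymb`).
-/
import Summits.HodgeConjecture.HodgeConjecture.Theorems.K2E1ChiPseudoEisensteinRadialCMThree          -- ★ C2 (K2E1-p13): `summable_comp_borelHeight_mul_cm_three` (θ_{f,ψ} converges absolutely)
import Summits.HodgeConjecture.HodgeConjecture.Theorems.R90S8ResGMidAtomTransOfFlatReexpansionU3     -- ★ (T_f) FILE B (C133-p02): `eisensteinSeriesU_finset_sum`; brings ★ `eisensteinSeriesU_rightTranslation`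
import Mathlib.Analysis.MellinTransform                                                                -- Mathlib `mellin`, `mellin_comp_mul_left`, `MellinConvergent.comp_mul_left`
import HarnessLib

/-!
# S8 (E) :276, E1-PLANCHEREL brick PB-3a — `R90S8PseudoEisensteinHeckeShiftU3`: THE HECKE SHIFT OF THE RADIAL PSEUDO-EISENSTEIN GENERATORS, `Σ_i c_i·θ_{f,ψ}(·k_i) = θ_{f♮,ψ}`

Track B ∕ R90-TF, crux h413 = `stmt-HodgeConjecture-24833`, route of record `HCCMUnconditional`; cell `hodgecm-mathlib`, R90-TF section S8 «ContSpec-n½ ∕ ResidualSpectrum», socket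
(E) `sock_S8_res_exhaustion_le_closure` (B :276), E1-PLANCHEREL BODY at the τ-cut block, brick PB-3a «unramified Hecke action on flat ∕ pseudo-Eisenstein sections at `v ∤ 𝔫`:
`R_f(𝟙_{K_v t_v K_v}) θ_{f,φ} = θ_{λ_v ⋆ f, φ}`, `(λ_v ⋆ f)^(z) = λ_v(z)·f̂(z)`» (the `hHecke`∕`hSymb` generator-level inputs of K2E1-p16 (g4)'s PB-3).  THEOREMS ONLY (no `def`, no `instance`,
no notation, no named-fact hypothesis, no `sorry`; default heartbeats); lane `--supports stmt-HodgeConjecture-24833 --as helper` (count-neutral).  CLOSES NO SOCKET.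

THE MATHEMATICS ([MoeglinWaldspurger1995] II.1.2, II.1.10; [Garrett2018] §2.8, §3.11; [BernsteinLapid2019] §4 Claim 1).  `θ_{f,ψ} := E((f∘H)·ψ)` (★ C2; `f ∈ C_c((0,∞))`, `ψ` a bounded
section) and, on right-`K_v`-invariant functions, the unramified Hecke operator `R_f(𝟙_{K_v t_v K_v})` is the finite sum of right translates `Σ_i R(k_i)` over `K_v t_v K_v = ⊔_i k_i K_v`.
(§2) The Eisenstein sum commutes with right translations (★ `eisensteinSeriesU_rightTranslation`) and with finite linear combinations where it converges absolutely (★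
`eisensteinSeriesU_finset_sum`; absolute convergence of `θ_{f,ψ}` at every point ★ C2 `summable_comp_borelHeight_mul_cm_three`), so `Σ_i c_i·θ_{f,ψ}(g·k_i) = E(Σ_i c_i·R(k_i)((f∘H)·ψ))(g)`.
(§3) THE LOCAL SATAKE LETTER `hloc` — «the Hecke operator acts on the section `(f∘H)·ψ` through the profile: `Σ_i c_i·(f(H(x k_i))·ψ(x k_i)) = f♮(H x)·ψ x`» (the unramified-principal-
series computation at `v`, inert `U(2,1)(L⁺_v)` or split; the census's L part, NAMED here) — then gives **`Σ_i c_i·θ_{f,ψ}(·k_i) = θ_{f♮,ψ}`**.  (§1) For the Satake-shaped shifted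
profile `f♮(r) = Σ_m a_m·f(q_m·r)` (`q_m > 0`): `f♮ ∈ C_c((0,∞))` again (so `θ_{f♮,ψ}` is a ★ C2 generator) and **`mellin f♮ s = (Σ_m a_m·q_m^{−s})·mellin f s`** (Mathlib
`mellin_comp_mul_left`) — PB-3's symbol row `hSymb` with `s_v(y) := λ_v(1+iy)`, `λ_v(s) := Σ_m a_m q_m^{−s}`.
* §1 `continuous_heckeShift`, `hasCompactSupport_heckeShift`, `heckeShift_eq_zero_of_le`, `tsupport_heckeShift_subset_Ioi`, `exists_pos_forall_le_eq_zero`, `tsupport_heckeShift_subset_Ioi_of_tsupport`,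
  `mellinConvergent_heckeShift`, **`mellin_heckeShift`**.
* §2 `summable_rightTranslation_pseudoEisensteinProfile`, **`sum_mul_pseudoEisenstein_rightTranslate_eq`**.
* §3 HEADS **`sum_mul_pseudoEisenstein_rightTranslate_eq_of_localLetter`**, **`sum_smul_rightTranslation_pseudoEisenstein_eq_of_localLetter`** (operator form).
HONEST LABEL: HC_CM is proved only modulo the 7 printed citations (2 remaining named inputs: hLiu418 = `stmt-HodgeConjecture-24832`, h413 = `stmt-HodgeConjecture-24833`) until rung 0
closes; REL ≠ ★ ≠ BUILT; PB-3a after this file = ★ MODULO {`hloc` (local Satake action on the section, L), the `L²`∕`integratedOperator` port `T_v(toLp F) = toLp(Σ_i F(·k_i))` (K2E1-p16 ∕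
F0P2-p10's (L1) currency)}; this file asserts no named fact and closes no socket; count-neutral.

## References
* [MoeglinWaldspurger1995] C. Mœglin, J.-L. Waldspurger, *Spectral Decomposition and Eisenstein Series* (1995): II.1.2, II.1.10.
* [Garrett2018] P. Garrett, *Modern Analysis of Automorphic Forms by Example* (2018): §2.8, §3.11.
* [BernsteinLapid2019] J. Bernstein, E. Lapid, *On the meromorphic continuation of Eisenstein series* (2019): §4 Claim 1.
-/

set_option autoImplicit false
set_option linter.dupNamespace false  -- the mandated namespace repeats the summit's segment (`HodgeConjecture.HodgeConjecture`)

noncomputable section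

open MeasureTheory Measure Set Filter Topology NumberField
open Literature.NumberTheory Literature.NumberTheory.Automorphic Literature.NumberTheory.Automorphic.UnitaryGroup AdelicGroupData
open Summit.HodgeConjecture.HodgeConjecture.Cruxes.H413.K2E1BorelEisensteinU
open Summit.HodgeConjecture.HodgeConjecture.Cruxes.H413.K2E1ChiPseudoEisensteinRadialCMThree (summable_comp_borelHeight_mul_cm_three)
open Summit.HodgeConjecture.HodgeConjecture.R90.S8 (eisensteinSeriesU_finset_sum eisensteinSeriesU_rightTranslation)
open scoped ENNReal NNReal

namespace Summit.HodgeConjecture.HodgeConjecture.Cruxes.H413.R90S8PseudoEisensteinHeckeShiftU3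

/-! ## §1 The Satake-shaped shifted profile `f♮(r) = Σ_m a_m·f(q_m·r)`: still in `C_c((0,∞))`, Mellin multiplier `Σ_m a_m·q_m^{−s}` -/

section Profile

variable {κ : Type*} (sm : Finset κ) (a : κ → ℂ) (q : κ → ℝ) (f : ℝ → ℂ)

/-- **`f♮` IS CONTINUOUS** when `f` is. [folklore] -/
theorem continuous_heckeShift (hfc : Continuous f) : Continuous fun r : ℝ => ∑ m ∈ sm, a m * f (q m * r) :=
  continuous_finsetSum _ fun _ _ => continuous_const.mul (hfc.comp (continuous_const.mul continuous_id))

/-- **`f♮` HAS COMPACT SUPPORT** when `f` has and every `q_m ≠ 0` (each dilate `r ↦ f(q_m·r)` is `f` through the homeomorphism `r ↦ q_m·r`; Mathlib `HasCompactSupport.finset_sum`). [folklore] -/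
theorem hasCompactSupport_heckeShift (hfs : HasCompactSupport f) (hq : ∀ m ∈ sm, q m ≠ 0) :
    HasCompactSupport fun r : ℝ => ∑ m ∈ sm, a m * f (q m * r) := by
  have hterm : ∀ m ∈ sm, HasCompactSupport fun r : ℝ => a m * f (q m * r) := fun m hm =>
    ((hfs.comp_homeomorph (Homeomorph.mulLeft₀ (q m) (hq m hm))).mul_left (f := fun _ => a m))
  have hfun : (fun r : ℝ => ∑ m ∈ sm, a m * f (q m * r)) = ∑ m ∈ sm, fun r : ℝ => a m * f (q m * r) := by
    funext r
    simp only [Finset.sum_apply]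
  rw [hfun]
  exact HasCompactSupport.finset_sum hterm

/-- **`f♮` VANISHES ON `(−∞, ε∕Q]`** if `f` vanishes on `(−∞, ε]` (`ε > 0`) and `0 < q_m ≤ Q`: every `q_m·r ≤ Q·r ≤ ε` there. [folklore] -/
theorem heckeShift_eq_zero_of_le {ε Q : ℝ} (hε : 0 < ε) (hQ : 0 < Q) (hq : ∀ m ∈ sm, 0 < q m ∧ q m ≤ Q) (hf : ∀ r ≤ ε, f r = 0)
    {r : ℝ} (hr : r ≤ ε / Q) : ∑ m ∈ sm, a m * f (q m * r) = 0 := by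
  refine Finset.sum_eq_zero fun m hm => ?_
  obtain ⟨hq0, hqQ⟩ := hq m hm
  have hqr : q m * r ≤ ε := by
    rcases le_or_gt 0 r with hr0 | hr0
    · calc q m * r ≤ Q * r := mul_le_mul_of_nonneg_right hqQ hr0
        _ ≤ Q * (ε / Q) := mul_le_mul_of_nonneg_left hr hQ.le
        _ = ε := mul_div_cancel₀ ε hQ.ne'
    · exact (mul_neg_of_pos_of_neg hq0 hr0).le.trans hε.le
  rw [hf _ hqr, mul_zero]

/-- **`tsupport f♮ ⊆ (0,∞)`** when `f` vanishes on some `(−∞, ε]`, `ε > 0` (which holds for `f ∈ C_c((0,∞))`: `tsupport f` compact inside `(0,∞)`) and `0 < q_m ≤ Q`: `f♮` vanishes on the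
open set `(−∞, ε∕Q)`, so its topological support avoids `(−∞, 0]`. [folklore] -/
theorem tsupport_heckeShift_subset_Ioi {ε Q : ℝ} (hε : 0 < ε) (hQ : 0 < Q) (hq : ∀ m ∈ sm, 0 < q m ∧ q m ≤ Q) (hf : ∀ r ≤ ε, f r = 0) :
    tsupport (fun r : ℝ => ∑ m ∈ sm, a m * f (q m * r)) ⊆ Ioi 0 := by
  intro r hr
  by_contra hle
  have hle' : r ≤ 0 := not_lt.1 hle
  -- `f♮` vanishes on the neighbourhood `(−∞, ε∕Q)` of `r`
  have hnhds : Iio (ε / Q) ∈ 𝓝 r := Iio_mem_nhds (hle'.trans_lt (div_pos hε hQ))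
  have hzero : (fun r : ℝ => ∑ m ∈ sm, a m * f (q m * r)) =ᶠ[𝓝 r] 0 :=
    Filter.mem_of_superset hnhds fun r' hr' => heckeShift_eq_zero_of_le sm a q f hε hQ hq hf (le_of_lt hr')
  exact (notMem_tsupport_iff_eventuallyEq.2 hzero) hr

/-- **`f ∈ C_c((0,∞))` VANISHES ON SOME `(−∞, ε]`, `ε > 0`**: `tsupport f` is compact (`hfs`) inside the open `(0,∞)` (`hf0`), hence inside `[ε, ∞)` for some `ε > 0`. [folklore] -/
theorem exists_pos_forall_le_eq_zero (hfs : HasCompactSupport f) (hf0 : tsupport f ⊆ Ioi 0) : ∃ ε : ℝ, 0 < ε ∧ ∀ r ≤ ε, f r = 0 := by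
  by_cases hne : (tsupport f).Nonempty
  · obtain ⟨r₀, hr₀, hlb⟩ := hfs.isCompact.exists_isLeast hne
    have hr₀pos : 0 < r₀ := hf0 hr₀
    refine ⟨r₀ / 2, half_pos hr₀pos, fun r hr => ?_⟩
    by_contra hfr
    have hle : r₀ ≤ r := hlb (subset_tsupport f hfr)
    linarith
  · refine ⟨1, one_pos, fun r _ => ?_⟩
    by_contra hfr
    exact hne ⟨r, subset_tsupport f hfr⟩

/-- **`tsupport f♮ ⊆ (0,∞)` FOR `f ∈ C_c((0,∞))` AND `q_m > 0`** — ★ C2's hypotheses `(hfc, hfs, hf0)` are inherited by the shifted profile (with `continuous_heckeShift`, `hasCompactSupport_heckeShift`), so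
`θ_{f♮,ψ}` is again a ★ C2 generator. [folklore] -/
theorem tsupport_heckeShift_subset_Ioi_of_tsupport (hfs : HasCompactSupport f) (hf0 : tsupport f ⊆ Ioi 0) (hq : ∀ m ∈ sm, 0 < q m) :
    tsupport (fun r : ℝ => ∑ m ∈ sm, a m * f (q m * r)) ⊆ Ioi 0 := by
  obtain ⟨ε, hε, hf⟩ := exists_pos_forall_le_eq_zero f hfs hf0
  have hsum : 0 ≤ ∑ m ∈ sm, q m := Finset.sum_nonneg fun m hm => (hq m hm).le
  refine tsupport_heckeShift_subset_Ioi sm a q f hε (Q := 1 + ∑ m ∈ sm, q m) (by linarith) (fun m hm => ⟨hq m hm, ?_⟩) hf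
  have hle : q m ≤ ∑ m' ∈ sm, q m' := Finset.single_le_sum (fun m' hm' => (hq m' hm').le) hm
  linarith

/-- **`f♮` IS MELLIN-CONVERGENT** where `f` is (`q_m > 0`; Mathlib `MellinConvergent.comp_mul_left`, finite sums). [cite: Garrett2018, §3.11] -/
theorem mellinConvergent_heckeShift {s : ℂ} (hq : ∀ m ∈ sm, 0 < q m) (hf : MellinConvergent f s) :
    MellinConvergent (fun r : ℝ => ∑ m ∈ sm, a m * f (q m * r)) s := by
  classical
  have hterm : ∀ m ∈ sm, MellinConvergent (fun r : ℝ => a m * f (q m * r)) s := fun m hm => by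
    have h := ((MellinConvergent.comp_mul_left (hq m hm)).2 hf).const_smul (a m)
    simpa only [smul_eq_mul] using h
  -- `MellinConvergent` is integrability of `t^{s−1} • ·` on `(0,∞)`: finite sums
  have hint : ∀ m ∈ sm, Integrable (fun t : ℝ => (t : ℂ) ^ (s - 1) • (a m * f (q m * t))) (volume.restrict (Ioi 0)) := fun m hm => hterm m hm
  have h : IntegrableOn (fun t : ℝ => ∑ m ∈ sm, (t : ℂ) ^ (s - 1) • (a m * f (q m * t))) (Ioi 0) := MeasureTheory.integrable_finsetSum sm hint
  refine (integrableOn_congr_fun (fun t _ => ?_) measurableSet_Ioi).1 h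
  simp only [smul_eq_mul, Finset.mul_sum]

/-- **THE MELLIN MULTIPLIER OF THE SHIFTED PROFILE**: `mellin f♮ s = (Σ_m a_m·q_m^{−s})·mellin f s` for `q_m > 0` wherever `f` is Mellin-convergent — Mathlib `mellin_comp_mul_left`
(`mellin (f(q·)) s = q^{−s}·mellin f s`) summed over `m`.  This is PB-3's symbol row: the continuous coordinate of `θ_{f♮,ψ}` is `λ_v(s)·` that of `θ_{f,ψ}`, `λ_v(s) = Σ_m a_m q_m^{−s}`.
[cite: Garrett2018, §3.11] [cite: MoeglinWaldspurger1995, II.1.10] -/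
theorem mellin_heckeShift {s : ℂ} (hq : ∀ m ∈ sm, 0 < q m) (hf : MellinConvergent f s) :
    mellin (fun r : ℝ => ∑ m ∈ sm, a m * f (q m * r)) s = (∑ m ∈ sm, a m * ((q m : ℝ) : ℂ) ^ (-s)) * mellin f s := by
  classical
  have hterm : ∀ m ∈ sm, MellinConvergent (fun r : ℝ => a m * f (q m * r)) s := fun m hm => by
    have h := ((MellinConvergent.comp_mul_left (hq m hm)).2 hf).const_smul (a m)
    simpa only [smul_eq_mul] using h
  have hsplit : mellin (fun r : ℝ => ∑ m ∈ sm, a m * f (q m * r)) s = ∑ m ∈ sm, mellin (fun r : ℝ => a m * f (q m * r)) s := by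
    have hint : ∀ m ∈ sm, Integrable (fun t : ℝ => (t : ℂ) ^ (s - 1) • (a m * f (q m * t))) (volume.restrict (Ioi 0)) := fun m hm => hterm m hm
    simp only [mellin]
    rw [← integral_finsetSum sm hint]
    refine setIntegral_congr_fun measurableSet_Ioi fun t _ => ?_
    simp only [smul_eq_mul, Finset.mul_sum]
  rw [hsplit, Finset.sum_mul]
  refine Finset.sum_congr rfl fun m hm => ?_
  have h1 : mellin (fun r : ℝ => a m * f (q m * r)) s = a m * mellin (fun r : ℝ => f (q m * r)) s := by
    have h := mellin_const_smul (fun r : ℝ => f (q m * r)) s (a m)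
    simpa only [smul_eq_mul] using h
  rw [h1, mellin_comp_mul_left f s (hq m hm), smul_eq_mul, mul_assoc]

end Profile

/-! ## §2 Finite sums of right translates of `θ_{f,ψ}` are pseudo-Eisenstein series of the translated profile section -/

section Eisenstein

variable (L : Type) [Field L] [NumberField L] [IsCMField L]

/-- **Every right translate of the profile section `(f∘H)·ψ` has an absolutely convergent Eisenstein sum** (`f ∈ C_c((0,∞))`, `ψ` bounded): ★ C2 `summable_comp_borelHeight_mul_cm_three` at
the point `x·k`. [cite: MoeglinWaldspurger1995, II.1.2] -/
theorem summable_rightTranslation_pseudoEisensteinProfile {f : ℝ → ℂ} (hfc : Continuous f) (hfs : HasCompactSupport f) (hf0 : tsupport f ⊆ Ioi 0)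
    {ψ : (quasiSplit (↥(maximalRealSubfield L)) L (IsCMField.complexConj L) 3).Adelic → ℂ} {M : ℝ} (hψM : ∀ x, ‖ψ x‖ ≤ M)
    (k x : (quasiSplit (↥(maximalRealSubfield L)) L (IsCMField.complexConj L) 3).Adelic) :
    Summable fun q : Quotient (MulAction.orbitRel ↥(borelU ((IsCMField.complexConj L : L ≃ₐ[↥(maximalRealSubfield L)] L) : L →+* L) ((StdForm.antidiagonal 3).over L)) ↥(unitaryGroupOfForm ((IsCMField.complexConj L : L ≃ₐ[↥(maximalRealSubfield L)] L) : L →+* L) ((StdForm.antidiagonal 3).over L))) =>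
      rightTranslation (quasiSplit (↥(maximalRealSubfield L)) L (IsCMField.complexConj L) 3) k
        (fun y : (quasiSplit (↥(maximalRealSubfield L)) L (IsCMField.complexConj L) 3).Adelic => f (borelHeight y : ℝ) * ψ y)
        ((quasiSplit (↥(maximalRealSubfield L)) L (IsCMField.complexConj L) 3).toAdelic (Quotient.out q : ↥(unitaryGroupOfForm ((IsCMField.complexConj L : L ≃ₐ[↥(maximalRealSubfield L)] L) : L →+* L) ((StdForm.antidiagonal 3).over L))) * x) := by
  refine (summable_comp_borelHeight_mul_cm_three L hfc hfs hf0 hψM (x * k)).congr fun q => ?_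
  simp only [rightTranslation_apply, mul_assoc]

/-- **`Σ_i c_i·θ_{f,ψ}(g·k_i) = E(Σ_i c_i·R(k_i)((f∘H)·ψ))(g)`**: the Eisenstein sum commutes with right translations (★ `eisensteinSeriesU_rightTranslation`) and with finite linear combinations
where each summand converges absolutely (★ `eisensteinSeriesU_finset_sum`, §2's summability). [cite: MoeglinWaldspurger1995, II.1.2] [cite: BernsteinLapid2019, §4 Claim 1] -/
theorem sum_mul_pseudoEisenstein_rightTranslate_eq {f : ℝ → ℂ} (hfc : Continuous f) (hfs : HasCompactSupport f) (hf0 : tsupport f ⊆ Ioi 0)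
    {ψ : (quasiSplit (↥(maximalRealSubfield L)) L (IsCMField.complexConj L) 3).Adelic → ℂ} {M : ℝ} (hψM : ∀ x, ‖ψ x‖ ≤ M)
    {ι : Type*} (s : Finset ι) (c : ι → ℂ) (k : ι → (quasiSplit (↥(maximalRealSubfield L)) L (IsCMField.complexConj L) 3).Adelic)
    (g : (quasiSplit (↥(maximalRealSubfield L)) L (IsCMField.complexConj L) 3).Adelic) :
    ∑ i ∈ s, c i * eisensteinSeriesU (fun y : (quasiSplit (↥(maximalRealSubfield L)) L (IsCMField.complexConj L) 3).Adelic => f (borelHeight y : ℝ) * ψ y) (g * k i) =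
      eisensteinSeriesU (∑ i ∈ s, c i • rightTranslation (quasiSplit (↥(maximalRealSubfield L)) L (IsCMField.complexConj L) 3) (k i)
        (fun y : (quasiSplit (↥(maximalRealSubfield L)) L (IsCMField.complexConj L) 3).Adelic => f (borelHeight y : ℝ) * ψ y)) g := by
  rw [eisensteinSeriesU_finset_sum L s c _ g fun i _ => summable_rightTranslation_pseudoEisensteinProfile L hfc hfs hf0 hψM (k i) g]
  refine Finset.sum_congr rfl fun i _ => ?_
  rw [eisensteinSeriesU_rightTranslation]

/-! ## §3 HEADS: the Hecke shift of the generators, modulo the local Satake letter `hloc` -/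

/-- **HEAD — `Σ_i c_i·θ_{f,ψ}(g·k_i) = θ_{f♮,ψ}(g)` MODULO THE LOCAL SATAKE LETTER.**  If the finite family of right translates acts on the profile SECTION through the profile —
`hloc : ∀ x, Σ_i c_i·(f(H(x·k_i))·ψ(x·k_i)) = f♮(H x)·ψ x` (the unramified-principal-series computation at the place `v`; with `K_v t_v K_v = ⊔_i k_i K_v`, `c_i := vol`, this is
`R_f(𝟙_{K_v t_v K_v})((f∘H)·ψ) = (λ_v ⋆ f ∘ H)·ψ`) — then the same holds for the pseudo-Eisenstein series: `Σ_i c_i·θ_{f,ψ}(g·k_i) = θ_{f♮,ψ}(g)` for every `g` (§2, then `hloc` under `E`).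
[cite: MoeglinWaldspurger1995, II.1.2, II.1.10] [cite: Garrett2018, §2.8] -/
theorem sum_mul_pseudoEisenstein_rightTranslate_eq_of_localLetter {f : ℝ → ℂ} (hfc : Continuous f) (hfs : HasCompactSupport f) (hf0 : tsupport f ⊆ Ioi 0)
    {ψ : (quasiSplit (↥(maximalRealSubfield L)) L (IsCMField.complexConj L) 3).Adelic → ℂ} {M : ℝ} (hψM : ∀ x, ‖ψ x‖ ≤ M)
    {ι : Type*} (s : Finset ι) (c : ι → ℂ) (k : ι → (quasiSplit (↥(maximalRealSubfield L)) L (IsCMField.complexConj L) 3).Adelic) (fd : ℝ → ℂ)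
    (hloc : ∀ x : (quasiSplit (↥(maximalRealSubfield L)) L (IsCMField.complexConj L) 3).Adelic,
      ∑ i ∈ s, c i * (f (borelHeight (x * k i) : ℝ) * ψ (x * k i)) = fd (borelHeight x : ℝ) * ψ x) :
    ∀ g : (quasiSplit (↥(maximalRealSubfield L)) L (IsCMField.complexConj L) 3).Adelic,
      ∑ i ∈ s, c i * eisensteinSeriesU (fun y : (quasiSplit (↥(maximalRealSubfield L)) L (IsCMField.complexConj L) 3).Adelic => f (borelHeight y : ℝ) * ψ y) (g * k i) =
        eisensteinSeriesU (fun y : (quasiSplit (↥(maximalRealSubfield L)) L (IsCMField.complexConj L) 3).Adelic => fd (borelHeight y : ℝ) * ψ y) g := by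
  intro g
  have hsec : (∑ i ∈ s, c i • rightTranslation (quasiSplit (↥(maximalRealSubfield L)) L (IsCMField.complexConj L) 3) (k i)
        (fun y : (quasiSplit (↥(maximalRealSubfield L)) L (IsCMField.complexConj L) 3).Adelic => f (borelHeight y : ℝ) * ψ y)) =
      fun y : (quasiSplit (↥(maximalRealSubfield L)) L (IsCMField.complexConj L) 3).Adelic => fd (borelHeight y : ℝ) * ψ y := by
    funext x
    simp only [Finset.sum_apply, Pi.smul_apply, smul_eq_mul, rightTranslation_apply]
    exact hloc x
  rw [sum_mul_pseudoEisenstein_rightTranslate_eq L hfc hfs hf0 hψM s c k g, hsec]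

/-- **HEAD, OPERATOR FORM — `Σ_i c_i·R(k_i) θ_{f,ψ} = θ_{f♮,ψ}`** as functions on `U(J₃)(𝔸_{L⁺})`, modulo the same local letter (K2E1-p16's `hHecke : T v (θ i) = θ (heckeShift v i)` once
`T v = Σ_i c_i·R(k_i)` on right-`K_v`-invariants). [cite: MoeglinWaldspurger1995, II.1.10] [cite: Garrett2018, §2.8] -/
theorem sum_smul_rightTranslation_pseudoEisenstein_eq_of_localLetter {f : ℝ → ℂ} (hfc : Continuous f) (hfs : HasCompactSupport f) (hf0 : tsupport f ⊆ Ioi 0)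
    {ψ : (quasiSplit (↥(maximalRealSubfield L)) L (IsCMField.complexConj L) 3).Adelic → ℂ} {M : ℝ} (hψM : ∀ x, ‖ψ x‖ ≤ M)
    {ι : Type*} (s : Finset ι) (c : ι → ℂ) (k : ι → (quasiSplit (↥(maximalRealSubfield L)) L (IsCMField.complexConj L) 3).Adelic) (fd : ℝ → ℂ)
    (hloc : ∀ x : (quasiSplit (↥(maximalRealSubfield L)) L (IsCMField.complexConj L) 3).Adelic,
      ∑ i ∈ s, c i * (f (borelHeight (x * k i) : ℝ) * ψ (x * k i)) = fd (borelHeight x : ℝ) * ψ x) :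
    (∑ i ∈ s, c i • rightTranslation (quasiSplit (↥(maximalRealSubfield L)) L (IsCMField.complexConj L) 3) (k i)
        (eisensteinSeriesU (fun y : (quasiSplit (↥(maximalRealSubfield L)) L (IsCMField.complexConj L) 3).Adelic => f (borelHeight y : ℝ) * ψ y))) =
      eisensteinSeriesU (fun y : (quasiSplit (↥(maximalRealSubfield L)) L (IsCMField.complexConj L) 3).Adelic => fd (borelHeight y : ℝ) * ψ y) := by
  funext g
  simp only [Finset.sum_apply, Pi.smul_apply, smul_eq_mul, rightTranslation_apply]
  exact sum_mul_pseudoEisenstein_rightTranslate_eq_of_localLetter L hfc hfs hf0 hψM s c k fd hloc g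

end Eisenstein

end Summit.HodgeConjecture.HodgeConjecture.Cruxes.H413.R90S8PseudoEisensteinHeckeShiftU3

end
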